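import Literature.Analysis.SpecialFunctions.LaguerreSoninEnvelope
import HarnessLib

/-!
# The oscillatory interval of `w = e^{-t²/2} tⁿ L_d^{(n-1/2)}(t²)` and Sonin's second function

Sequel of `LaguerreSoninEnvelope.lean` (Szegő (5.1.2), third normal form `w″ + Q w = 0`,
`Q(t) = (4d + 2n + 1) - t² - n(n-1)/t²`, peak `t_M = (n(n-1))^{1/4}`, first Sonin function
`G = Q w² + w′²` with `G ≤ G(t_M)`). Here (`n ≥ 2`, so that `n(n-1) > 0`):

* the OSCILLATORY INTERVAL `(t₋, t₊)`, `t_∓² = (c ∓ √(c² - 4n(n-1)))/2`, `c = 4d + 2n + 1`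
  (`laguerreTMinus`, `laguerreTPlus`): `Q(t) = -(t² - t₋²)(t² - t₊²)/t²`, so `Q > 0` exactly on
  `(t₋, t₊)` (`laguerreNormalQ_pos_iff`), `Q(t_±) = 0`, `t₋ < t_M < t₊`, and
  `0 < Q(t_M) = c - 2√(n(n-1)) ≤ 4d + 3` (`laguerreNormalQ_peak_pos_le`) — Szegő Thm. 6.31.2 places all
  zeros of `L_d^{(α)}(t²)` in this interval;
* Sonin's SECOND FUNCTION `F = w² + w′²/Q` (`soninF`): `F′ = -Q′ w′²/Q²`, hence `F(t_M) ≤ F(t)` on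
  `(t₋, t₊)` (`soninF_peak_le`), and `G(t_M) = Q(t_M) F(t_M)`;
* the two consequences consumed by the Jensen-polynomial threshold for `ξ`
  (`Literature/NumberTheory/LFunctions/JensenXiExponentialRange.lean`): at an interior critical point
  `t*` of `w`, `Q(t_M) · w(t*)² ≥ G(t_M)` (`soninG_peak_le_of_deriv_eq_zero`); on the closed interval
  `[t₋, t₊]`, `w′(t)² ≤ G(t_M)` (`laguerreNormalDeriv_sq_le_of_mem`).

## References
* [Szego1975] G. Szegő, *Orthogonal Polynomials*, 4th ed. (1975), (5.1.2), Thm. 6.31.2 (bounds for the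
  zeros of `L_n^{(α)}` from the sign of the coefficient of the normal form), §7.31 / Thm. 7.31.1 (Sonin).
-/

noncomputable section

open Polynomial Set

namespace Literature.Analysis.SpecialFunctions

variable (n d : ℕ)

/-! ### The oscillatory interval `(t₋, t₊)` where `Q > 0` -/

/-- `t₋² = (c - √(c² - 4n(n-1)))/2`, `c = 4d + 2n + 1`. [cite: Szego1975, Thm. 6.31.2] -/
def laguerreTMinusSq : ℝ :=
  ((4 * (d : ℝ) + 2 * n + 1) - Real.sqrt ((4 * (d : ℝ) + 2 * n + 1) ^ 2
    - 4 * ((n : ℝ) * ((n : ℝ) - 1)))) / 2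

/-- `t₊² = (c + √(c² - 4n(n-1)))/2`, `c = 4d + 2n + 1`. [cite: Szego1975, Thm. 6.31.2] -/
def laguerreTPlusSq : ℝ :=
  ((4 * (d : ℝ) + 2 * n + 1) + Real.sqrt ((4 * (d : ℝ) + 2 * n + 1) ^ 2
    - 4 * ((n : ℝ) * ((n : ℝ) - 1)))) / 2

/-- `t₋ = √(t₋²)`, the left end of the oscillatory interval. [cite: Szego1975, Thm. 6.31.2] -/
def laguerreTMinus : ℝ := Real.sqrt (laguerreTMinusSq n d)

/-- `t₊ = √(t₊²)`, the right end of the oscillatory interval. [cite: Szego1975, Thm. 6.31.2] -/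
def laguerreTPlus : ℝ := Real.sqrt (laguerreTPlusSq n d)

/-- The discriminant `c² - 4n(n-1) = 16d² + 16dn + 8d + 8n + 1` is positive. [folklore] -/
private theorem laguerre_disc_pos :
    0 < (4 * (d : ℝ) + 2 * n + 1) ^ 2 - 4 * ((n : ℝ) * ((n : ℝ) - 1)) := by
  have hd : (0 : ℝ) ≤ d := Nat.cast_nonneg d
  have hn : (0 : ℝ) ≤ n := Nat.cast_nonneg n
  nlinarith

/-- Vieta: `t₋² + t₊² = c` and `t₋² · t₊² = n(n-1)`. [cite: Szego1975, Thm. 6.31.2] -/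
theorem laguerreTSq_vieta :
    laguerreTMinusSq n d + laguerreTPlusSq n d = 4 * (d : ℝ) + 2 * n + 1 ∧
    laguerreTMinusSq n d * laguerreTPlusSq n d = (n : ℝ) * ((n : ℝ) - 1) := by
  have hD := Real.sq_sqrt (laguerre_disc_pos n d).le
  unfold laguerreTMinusSq laguerreTPlusSq
  constructor
  · ring
  · nlinarith [hD]

/-- `0 < t₋² < t₊²` for `n ≥ 2`. [cite: Szego1975, Thm. 6.31.2] -/
theorem laguerreTSq_pos_lt (hn : 2 ≤ n) :
    0 < laguerreTMinusSq n d ∧ laguerreTMinusSq n d < laguerreTPlusSq n d := by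
  have hD0 := laguerre_disc_pos n d
  have hs : 0 < Real.sqrt ((4 * (d : ℝ) + 2 * n + 1) ^ 2 - 4 * ((n : ℝ) * ((n : ℝ) - 1))) :=
    Real.sqrt_pos.2 hD0
  have hn' : (2 : ℝ) ≤ n := by exact_mod_cast hn
  have hm : 0 < (n : ℝ) * ((n : ℝ) - 1) := mul_pos (by linarith) (by linarith)
  obtain ⟨hsum, hprod⟩ := laguerreTSq_vieta n d
  have hlt : laguerreTMinusSq n d < laguerreTPlusSq n d := by
    unfold laguerreTMinusSq laguerreTPlusSq; linarith
  have hplus : 0 < laguerreTPlusSq n d := by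
    unfold laguerreTPlusSq; have hd : (0 : ℝ) ≤ d := Nat.cast_nonneg d; positivity
  refine ⟨?_, hlt⟩
  by_contra h
  rw [not_lt] at h
  have : laguerreTMinusSq n d * laguerreTPlusSq n d ≤ 0 := mul_nonpos_of_nonpos_of_nonneg h hplus.le
  linarith

/-- **Factorisation of `Q`**: `Q(t) = -(t² - t₋²)(t² - t₊²)/t²` for `t ≠ 0`. [cite: Szego1975, Thm. 6.31.2] -/
theorem laguerreNormalQ_eq_factor {t : ℝ} (ht : t ≠ 0) :
    laguerreNormalQ n d t =
      -((t ^ 2 - laguerreTMinusSq n d) * (t ^ 2 - laguerreTPlusSq n d)) / t ^ 2 := by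
  obtain ⟨hsum, hprod⟩ := laguerreTSq_vieta n d
  unfold laguerreNormalQ
  field_simp
  linear_combination (-(t ^ 2)) * hsum + hprod

/-- **`Q(t) > 0 ⟺ t₋ < t < t₊`** for `t > 0` (`n ≥ 2`). [cite: Szego1975, Thm. 6.31.2] -/
theorem laguerreNormalQ_pos_iff (hn : 2 ≤ n) {t : ℝ} (ht : 0 < t) :
    0 < laguerreNormalQ n d t ↔ laguerreTMinus n d < t ∧ t < laguerreTPlus n d := by
  obtain ⟨-, hlt⟩ := laguerreTSq_pos_lt n d hn
  have ht2 : 0 < t ^ 2 := pow_pos ht 2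
  rw [laguerreNormalQ_eq_factor n d ht.ne', laguerreTMinus, laguerreTPlus,
    Real.sqrt_lt' ht, Real.lt_sqrt ht.le, neg_div, neg_pos, div_lt_iff₀ ht2, zero_mul, mul_neg_iff]
  constructor
  · rintro (⟨ha, hb⟩ | ⟨ha, hb⟩)
    · exact ⟨sub_pos.1 ha, sub_neg.1 hb⟩
    · exfalso
      have h1 := sub_neg.1 ha
      have h2 := sub_pos.1 hb
      linarith
  · rintro ⟨h1, h2⟩
    exact Or.inl ⟨sub_pos.2 h1, sub_neg.2 h2⟩

/-- `Q(t₋) = 0` and `Q(t₊) = 0` (`n ≥ 2`). [cite: Szego1975, Thm. 6.31.2] -/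
theorem laguerreNormalQ_tMinus_tPlus (hn : 2 ≤ n) :
    laguerreNormalQ n d (laguerreTMinus n d) = 0 ∧ laguerreNormalQ n d (laguerreTPlus n d) = 0 := by
  obtain ⟨h0, hlt⟩ := laguerreTSq_pos_lt n d hn
  have h1 : 0 < laguerreTMinus n d := Real.sqrt_pos.2 h0
  have h2 : 0 < laguerreTPlus n d := Real.sqrt_pos.2 (h0.trans hlt)
  refine ⟨?_, ?_⟩
  · rw [laguerreNormalQ_eq_factor n d h1.ne', laguerreTMinus, Real.sq_sqrt h0.le]; simp
  · rw [laguerreNormalQ_eq_factor n d h2.ne', laguerreTPlus, Real.sq_sqrt (h0.trans hlt).le]; simp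

/-- `0 < t₋ < t₊` (`n ≥ 2`). [cite: Szego1975, Thm. 6.31.2] -/
theorem laguerreTMinus_pos_lt (hn : 2 ≤ n) :
    0 < laguerreTMinus n d ∧ laguerreTMinus n d < laguerreTPlus n d := by
  obtain ⟨h0, hlt⟩ := laguerreTSq_pos_lt n d hn
  exact ⟨Real.sqrt_pos.2 h0, Real.sqrt_lt_sqrt h0.le hlt⟩

/-- `Q ≤ 0` off the oscillatory interval: for `t > 0` with `t ≤ t₋` or `t₊ ≤ t`. [cite: Szego1975, Thm. 6.31.2] -/
theorem laguerreNormalQ_nonpos_of_not_mem (hn : 2 ≤ n) {t : ℝ} (ht : 0 < t)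
    (h : t ≤ laguerreTMinus n d ∨ laguerreTPlus n d ≤ t) : laguerreNormalQ n d t ≤ 0 := by
  by_contra hQ
  obtain ⟨h1, h2⟩ := (laguerreNormalQ_pos_iff n d hn ht).1 (lt_of_not_ge hQ)
  rcases h with h | h <;> linarith

/-- **`Q(t_M) = c - 2√(n(n-1))`**, the maximum of `Q`. [cite: Szego1975, (5.1.2)] -/
theorem laguerreNormalQ_peak (hn : 2 ≤ n) :
    laguerreNormalQ n d (laguerrePeak n) =
      4 * (d : ℝ) + 2 * n + 1 - 2 * Real.sqrt ((n : ℝ) * ((n : ℝ) - 1)) := by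
  have hn' : (2 : ℝ) ≤ n := by exact_mod_cast hn
  have hm : 0 < (n : ℝ) * ((n : ℝ) - 1) := mul_pos (by linarith) (by linarith)
  have hs : 0 < Real.sqrt ((n : ℝ) * ((n : ℝ) - 1)) := Real.sqrt_pos.2 hm
  have h2 : laguerrePeak n ^ 2 = Real.sqrt ((n : ℝ) * ((n : ℝ) - 1)) := by
    rw [laguerrePeak, Real.sq_sqrt hs.le]
  unfold laguerreNormalQ
  rw [h2, ← Real.sq_sqrt hm.le]
  rw [Real.sqrt_sq hs.le]
  field_simp
  ring

/-- `0 < Q(t_M) ≤ 4d + 3` (`2√(n(n-1)) ≥ 2n - 2` and `< 2n + 4d + 1`). [cite: Szego1975, (5.1.2)] -/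
theorem laguerreNormalQ_peak_pos_le (hn : 2 ≤ n) :
    0 < laguerreNormalQ n d (laguerrePeak n) ∧ laguerreNormalQ n d (laguerrePeak n) ≤ 4 * d + 3 := by
  rw [laguerreNormalQ_peak n d hn]
  have hn' : (2 : ℝ) ≤ n := by exact_mod_cast hn
  have hd : (0 : ℝ) ≤ d := Nat.cast_nonneg d
  have hm : 0 < (n : ℝ) * ((n : ℝ) - 1) := mul_pos (by linarith) (by linarith)
  set s := Real.sqrt ((n : ℝ) * ((n : ℝ) - 1)) with hs
  have hs0 : 0 ≤ s := Real.sqrt_nonneg _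
  have hss : s ^ 2 = (n : ℝ) * ((n : ℝ) - 1) := Real.sq_sqrt hm.le
  constructor
  · -- `s < n`, since `s² = n² - n < n²`
    nlinarith
  · -- `n - 1 ≤ s`, since `(n-1)² ≤ n(n-1)`
    nlinarith

/-- `t₋ < t_M < t₊` (`Q(t_M) > 0`). [cite: Szego1975, Thm. 6.31.2] -/
theorem laguerrePeak_mem (hn : 2 ≤ n) :
    laguerreTMinus n d < laguerrePeak n ∧ laguerrePeak n < laguerreTPlus n d :=
  (laguerreNormalQ_pos_iff n d hn (laguerrePeak_pos n hn)).1 (laguerreNormalQ_peak_pos_le n d hn).1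

/-! ### The second Sonin function `F = w² + w′²/Q` on the oscillatory interval -/

/-- Sonin's function `F(t) = w(t)² + w′(t)²/Q(t)` (meaningful where `Q > 0`). [cite: Szego1975, §7.31] -/
def soninF (t : ℝ) : ℝ :=
  laguerreNormal n d t ^ 2 + laguerreNormalDeriv n d t ^ 2 / laguerreNormalQ n d t

/-- **`F′ = -Q′ w′²/Q²`** where `Q ≠ 0` (the terms `2ww′` cancel by `w″ = -Q w`).
[cite: Szego1975, Thm. 7.31.1] -/
theorem hasDerivAt_soninF {t : ℝ} (ht : t ≠ 0) (hQ : laguerreNormalQ n d t ≠ 0) :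
    HasDerivAt (soninF n d)
      (-(laguerreNormalQDeriv n t) * laguerreNormalDeriv n d t ^ 2 / laguerreNormalQ n d t ^ 2) t := by
  have hQ' := hasDerivAt_laguerreNormalQ n d ht
  have hw := hasDerivAt_laguerreNormal n d ht
  have hw1 := hasDerivAt_laguerreNormalDeriv n d ht
  have h : HasDerivAt (soninF n d) _ t := (hw.pow 2).add ((hw1.pow 2).div hQ' hQ)
  refine h.congr_deriv ?_
  simp only [Pi.pow_apply]
  push_cast
  field_simp
  ring

/-- `F` is continuous at every point of the oscillatory interval. [cite: Szego1975, Thm. 7.31.1] -/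
theorem continuousAt_soninF (hn : 2 ≤ n) {t : ℝ} (h1 : laguerreTMinus n d < t)
    (h2 : t < laguerreTPlus n d) : ContinuousAt (soninF n d) t := by
  have ht : 0 < t := lt_trans (laguerreTMinus_pos_lt n d hn).1 h1
  have hQ := (laguerreNormalQ_pos_iff n d hn ht).2 ⟨h1, h2⟩
  exact (hasDerivAt_soninF n d ht.ne' hQ.ne').continuousAt

/-- **Sonin: `F(t_M) ≤ F(t)` on the oscillatory interval** (`F` decreases on `(t₋, t_M]`,
increases on `[t_M, t₊)`). [cite: Szego1975, Thm. 7.31.1] -/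
theorem soninF_peak_le (hn : 2 ≤ n) {t : ℝ} (h1 : laguerreTMinus n d < t)
    (h2 : t < laguerreTPlus n d) : soninF n d (laguerrePeak n) ≤ soninF n d t := by
  have hn1 : 1 ≤ n := le_trans (by norm_num) hn
  obtain ⟨hM1, hM2⟩ := laguerrePeak_mem n d hn
  have h0 := (laguerreTMinus_pos_lt n d hn).1
  -- derivative sign helper
  have hder : ∀ x, laguerreTMinus n d < x → x < laguerreTPlus n d →
      HasDerivAt (soninF n d) (-(laguerreNormalQDeriv n x) * laguerreNormalDeriv n d x ^ 2 /
        laguerreNormalQ n d x ^ 2) x := fun x hx1 hx2 => by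
    have hx : 0 < x := lt_trans h0 hx1
    exact hasDerivAt_soninF n d hx.ne' ((laguerreNormalQ_pos_iff n d hn hx).2 ⟨hx1, hx2⟩).ne'
  rcases le_or_gt t (laguerrePeak n) with h | h
  · have hanti : AntitoneOn (soninF n d) (Icc t (laguerrePeak n)) := by
      refine antitoneOn_of_hasDerivWithinAt_nonpos (convex_Icc _ _)
        (f' := fun x => -(laguerreNormalQDeriv n x) * laguerreNormalDeriv n d x ^ 2 /
          laguerreNormalQ n d x ^ 2)
        (fun x hx => (continuousAt_soninF n d hn (lt_of_lt_of_le h1 hx.1)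
          (lt_of_le_of_lt hx.2 hM2)).continuousWithinAt)
        (fun x hx => ?_) (fun x hx => ?_)
      · rw [interior_Icc] at hx
        exact (hder x (h1.trans hx.1) (hx.2.trans hM2)).hasDerivWithinAt
      · rw [interior_Icc] at hx
        have hx0 : 0 < x := lt_trans h0 (h1.trans hx.1)
        have := laguerreNormalQDeriv_nonneg n hn1 hx0 hx.2.le
        exact div_nonpos_of_nonpos_of_nonneg
          (mul_nonpos_of_nonpos_of_nonneg (neg_nonpos.2 this) (sq_nonneg _)) (sq_nonneg _)
    exact hanti (left_mem_Icc.2 h) (right_mem_Icc.2 h) h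
  · have hmono : MonotoneOn (soninF n d) (Icc (laguerrePeak n) t) := by
      refine monotoneOn_of_hasDerivWithinAt_nonneg (convex_Icc _ _)
        (f' := fun x => -(laguerreNormalQDeriv n x) * laguerreNormalDeriv n d x ^ 2 /
          laguerreNormalQ n d x ^ 2)
        (fun x hx => (continuousAt_soninF n d hn (lt_of_lt_of_le hM1 hx.1)
          (lt_of_le_of_lt hx.2 h2)).continuousWithinAt)
        (fun x hx => ?_) (fun x hx => ?_)
      · rw [interior_Icc] at hx
        exact (hder x (hM1.trans hx.1) (hx.2.trans h2)).hasDerivWithinAt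
      · rw [interior_Icc] at hx
        have hx0 : 0 < x := lt_trans h0 (hM1.trans hx.1)
        have := laguerreNormalQDeriv_nonpos n hn1 hx0 hx.1.le
        exact div_nonneg (mul_nonneg (neg_nonneg.2 this) (sq_nonneg _)) (sq_nonneg _)
    exact hmono (left_mem_Icc.2 h.le) (right_mem_Icc.2 h.le) h.le

/-- `G(t_M) = Q(t_M) · F(t_M)`. [cite: Szego1975, §7.31] -/
theorem soninG_peak_eq (hn : 2 ≤ n) :
    soninG n d (laguerrePeak n) = laguerreNormalQ n d (laguerrePeak n) * soninF n d (laguerrePeak n) := by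
  have hQ := (laguerreNormalQ_peak_pos_le n d hn).1
  unfold soninG soninF
  field_simp

/-- **The amplitude at an interior critical point**: if `t₋ < t < t₊` and `w′(t) = 0`, then
`G(t_M) ≤ Q(t_M) · w(t)²` (`w(t)² = F(t) ≥ F(t_M) = G(t_M)/Q(t_M)`). [cite: Szego1975, Thm. 7.31.1] -/
theorem soninG_peak_le_of_deriv_eq_zero (hn : 2 ≤ n) {t : ℝ} (h1 : laguerreTMinus n d < t)
    (h2 : t < laguerreTPlus n d) (hcrit : laguerreNormalDeriv n d t = 0) :
    soninG n d (laguerrePeak n) ≤ laguerreNormalQ n d (laguerrePeak n) * laguerreNormal n d t ^ 2 := by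
  have hQ := (laguerreNormalQ_peak_pos_le n d hn).1
  have hF := soninF_peak_le n d hn h1 h2
  have hFt : soninF n d t = laguerreNormal n d t ^ 2 := by simp [soninF, hcrit]
  rw [soninG_peak_eq n d hn, ← hFt]
  exact mul_le_mul_of_nonneg_left hF hQ.le

/-- **The slope bound on the oscillatory interval (closed)**: for `t₋ ≤ t ≤ t₊`,
`w′(t)² ≤ G(t_M)` (there `Q(t) ≥ 0`, so `w′² ≤ Q w² + w′² = G ≤ G(t_M)`). [cite: Szego1975, Thm. 7.31.1] -/
theorem laguerreNormalDeriv_sq_le_of_mem (hn : 2 ≤ n) {t : ℝ} (h1 : laguerreTMinus n d ≤ t)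
    (h2 : t ≤ laguerreTPlus n d) : laguerreNormalDeriv n d t ^ 2 ≤ soninG n d (laguerrePeak n) := by
  have h0 := (laguerreTMinus_pos_lt n d hn).1
  have ht : 0 < t := lt_of_lt_of_le h0 h1
  have hQ : 0 ≤ laguerreNormalQ n d t := by
    rcases h1.eq_or_lt with h1 | h1
    · rw [← h1, (laguerreNormalQ_tMinus_tPlus n d hn).1]
    rcases h2.eq_or_lt with h2 | h2
    · rw [h2, (laguerreNormalQ_tMinus_tPlus n d hn).2]
    exact ((laguerreNormalQ_pos_iff n d hn ht).2 ⟨h1, h2⟩).le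
  calc laguerreNormalDeriv n d t ^ 2
      ≤ laguerreNormalQ n d t * laguerreNormal n d t ^ 2 + laguerreNormalDeriv n d t ^ 2 := by
        nlinarith [sq_nonneg (laguerreNormal n d t)]
    _ = soninG n d t := rfl
    _ ≤ soninG n d (laguerrePeak n) := soninG_le_peak n d hn ht

end Literature.Analysis.SpecialFunctions
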